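import Summits.HodgeConjecture.CorCM.IrreducibleOddWeightsSubmodular
import HarnessLib

/-!
# Leave-one-out: a family of CM types is nondegenerate iff EVERY member adds its full dimension on top of all the
# others

COR-CM (cell `pub-hodgecm2`, binder seat `b16` gen 56, count-neutral claim MAX-NONDEG (D-RANK), file F8 — abstract
`G`-set level and CM dress, sequel of F7 `CorCM/IrreducibleOddWeightsSubmodular`; theorems only, no definition, no
named fact, no `sorry`).  NEW as stated, hence under `Summits/`.  HONEST FRAMING: finite-dimensional linear algebra
about the Kubota–Dodson rank of families of CM types, read on Mumford–Tate groups of products of abelian varieties with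
complex multiplication; NO hypothesis on the slots (any CM fields, any types); `HC_CM` is neither used nor asserted.

Write `d(S) = dim U(Σ|_S)` for a set of members `S` (`= dim Hg(∏_{i∈S} A_i)`), `m_i = |E_i|/2` (`= dim A_i`).  By F7,
`d` is submodular; with sub-additivity (`d(S ∪ {i}) ≤ d(S) + m_i`) an induction on `|S|` gives:

> **`finrank_antiSpan_sigmaType_eq_sum_of_forall_erase`** — if `d(S) = d(S ∖ {i}) + m_i` for EVERY `i ∈ S` (each
> member contributes its full `m_i` ON TOP OF ALL THE OTHERS), then `d(S) = Σ_{i∈S} m_i`: the family `S` is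
> NONDEGENERATE.  Conversely (`finrank_antiSpan_sigmaType_erase_of_eq_sum`) a nondegenerate `S` has
> `d(S) = d(S ∖ {i}) + m_i` for all `i ∈ S`.

CM dress (**`isNondegenerateFamily_iff_forall_erase`**, any CM fields, `|I| ≥ 2`): `(Φ_i)_{i∈I}` is a nondegenerate
family — `Hg(∏ A_i) = ∏ Hg(A_i)`, the Hodge conjecture on all products of powers (tree) — IFF for every `i`,
`dim MT(∏_j A_j) = dim MT(∏_{j≠i} A_j) + dim A_i`.  Degeneracy is therefore always WITNESSED BY ONE MEMBER that fails
to add its full dimension to the product of all the others (`exists_cmFamilyRank_lt_of_not_isNondegenerateFamily`).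

## References

* [Gordon1999HodgeAVSurvey] B. B. Gordon, *A survey of the Hodge conjecture for abelian varieties*, §3 Theorem (proof),
  7.5–7.7, 9.1.
* [Deligne1982HodgeCycles] P. Deligne, *Hodge cycles on abelian varieties*, LNM 900 (1982), I Ex. 3.7 (c)–(d).
* [MoonenZarhin1999LowDim] B. Moonen, Yu. Zarhin, *Hodge classes on abelian varieties of low dimension*, Math. Ann.
  315 (1999), §3 (3.1).
-/

set_option autoImplicit false

noncomputable section

open scoped BigOperators

namespace Summit.HodgeConjecture.CorCM.IrrOdd

open Literature.NumberTheory.ComplexMultiplication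

variable {G : Type*} [Group G] {I : Type*} {E : I → Type*} [∀ i, MulAction G (E i)]

/-! ### §1 Sub-additivity of one slot and the empty family -/

section Tools

variable [DecidableEq I] [Fintype I] [∀ i, Fintype (E i)] {ρ : G}

omit [DecidableEq I] [Fintype I] [∀ i, Fintype (E i)] in
/-- The empty sub-family has `dim U = 0`. [folklore] -/
theorem finrank_antiSpan_sigmaType_eq_zero_of_isEmpty (Φ : ∀ i, Set (E i)) (p : I → Prop)
    (hp : ∀ i, ¬ p i) : Module.finrank ℚ (antiSpan G (sigmaType fun j : {i // p i} => Φ j.1)) = 0 := by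
  have : antiSpan G (sigmaType fun j : {i // p i} => Φ j.1) = ⊥ := by
    rw [eq_bot_iff]
    intro f _
    rw [Submodule.mem_bot]
    funext x
    exact (hp x.1.1 x.1.2).elim
  rw [this, finrank_bot]

omit [DecidableEq I] [Fintype I] in
/-- A one-member sub-family has `dim U(Σ|_{{i₀}}) ≤ |E_{i₀}|/2`. [cite: Shimura1998, §32.10] -/
theorem finrank_antiSpan_sigmaType_single_le (Φ : ∀ i, Set (E i)) (h : ∀ i, IsCMTypeWith ρ (Φ i)) (p : I → Prop)
    {i₀ : I} (hp : ∀ i, p i ↔ i = i₀) :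
    Module.finrank ℚ (antiSpan G (sigmaType fun j : {i // p i} => Φ j.1)) ≤ Fintype.card (E i₀) / 2 := by
  classical
  haveI : Fintype {i // p i} := Fintype.subtype {i₀} fun i => by rw [Finset.mem_singleton, hp]
  rcases isEmpty_or_nonempty (E i₀) with hE | hE
  · have : Module.finrank ℚ ((Σ j : {i // p i}, E j.1) → ℚ) = 0 := by
      rw [Module.finrank_fintype_fun_eq_card, Fintype.card_eq_zero_iff]
      exact ⟨fun x => by
        obtain ⟨⟨j, hj⟩, s⟩ := x
        obtain rfl : j = i₀ := (hp j).1 hj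
        exact hE.false s⟩
    have h0 := Submodule.finrank_le (antiSpan G (sigmaType fun j : {i // p i} => Φ j.1))
    omega
  · obtain ⟨s₀⟩ := hE
    haveI : Nonempty (Σ j : {i // p i}, E j.1) := ⟨⟨⟨i₀, (hp i₀).2 rfl⟩, s₀⟩⟩
    have hrk := (IsCMTypeWith.sigmaType (E := fun j : {i // p i} => E j.1) fun j => h j.1).typeRank_le
    rw [(IsCMTypeWith.sigmaType (E := fun j : {i // p i} => E j.1) fun j => h j.1).typeRank_eq_finrank_antiSpan_add_one,
      Fintype.card_sigma] at hrk
    have hcard : ∑ j : {i // p i}, Fintype.card (E j.1) = Fintype.card (E i₀) := by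
      rw [Fintype.sum_eq_single (⟨i₀, (hp i₀).2 rfl⟩ : {i // p i}) fun j hj => absurd
        (Subtype.ext ((hp j.1).1 j.2)) hj]
    omega

omit [DecidableEq I] in
/-- **Sub-additivity of one slot**: `dim U(Σ|_{p ∪ {i₀}}) ≤ dim U(Σ|_p) + |E_{i₀}|/2` (F7 with the empty sub-family,
and the one-member bound). [cite: Gordon1999HodgeAVSurvey, §3 Theorem (proof) and 7.7] -/
theorem finrank_antiSpan_sigmaType_insert_le (Φ : ∀ i, Set (E i)) (h : ∀ i, IsCMTypeWith ρ (Φ i)) (p q : I → Prop)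
    {i₀ : I} (hq : ∀ i, q i ↔ p i ∨ i = i₀) :
    Module.finrank ℚ (antiSpan G (sigmaType fun j : {i // q i} => Φ j.1)) ≤
      Module.finrank ℚ (antiSpan G (sigmaType fun j : {i // p i} => Φ j.1)) + Fintype.card (E i₀) / 2 := by
  have hsub := finrank_antiSpan_sigmaType_submodular (G := G) Φ (fun _ => False) p (fun i => i = i₀) q
    (fun _ h => h.elim) (fun i => by simp only [false_or]) hq
  have h0 := finrank_antiSpan_sigmaType_eq_zero_of_isEmpty (G := G) Φ (fun _ => False) fun _ h => h
  have h1 := finrank_antiSpan_sigmaType_single_le (G := G) Φ h (fun i => i = i₀) fun _ => Iff.rfl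
  omega

end Tools

/-! ### §2 Leave-one-out -/

section LeaveOneOut

variable [DecidableEq I] [Fintype I] [∀ i, Fintype (E i)] {ρ : G}

/-- **A nondegenerate sub-family loses exactly `|E_{i₀}|/2` when a member is removed**: if `dim U(Σ|_T) = Σ_{i∈T} |E_i|/2`
then `dim U(Σ|_T) = dim U(Σ|_{T ∖ {i₀}}) + |E_{i₀}|/2` for every `i₀ ∈ T`. [cite: Gordon1999HodgeAVSurvey, 7.6.1 and 7.7] -/
theorem finrank_antiSpan_sigmaType_erase_of_eq_sum (Φ : ∀ i, Set (E i)) (h : ∀ i, IsCMTypeWith ρ (Φ i))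
    (T : Finset I) (hT : Module.finrank ℚ (antiSpan G (sigmaType fun j : {i // i ∈ T} => Φ j.1)) =
      ∑ i ∈ T, Fintype.card (E i) / 2) {i₀ : I} (hi₀ : i₀ ∈ T) :
    Module.finrank ℚ (antiSpan G (sigmaType fun j : {i // i ∈ T} => Φ j.1)) =
      Module.finrank ℚ (antiSpan G (sigmaType fun j : {i // i ∈ T.erase i₀} => Φ j.1)) + Fintype.card (E i₀) / 2 := by
  have hle := finrank_antiSpan_sigmaType_insert_le (G := G) Φ h (· ∈ T.erase i₀) (· ∈ T) (i₀ := i₀) fun i => by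
    rw [Finset.mem_erase]
    constructor
    · intro hi
      by_cases hii : i = i₀
      · exact Or.inr hii
      · exact Or.inl ⟨hii, hi⟩
    · rintro (⟨-, hi⟩ | rfl)
      · exact hi
      · exact hi₀
  -- the erased family is bounded by its own sum
  have hup : Module.finrank ℚ (antiSpan G (sigmaType fun j : {i // i ∈ T.erase i₀} => Φ j.1)) ≤
      ∑ i ∈ T.erase i₀, Fintype.card (E i) / 2 := by
    classical
    refine (finrank_antiSpan_sigmaType_le (G := G) (E := fun j : {i // i ∈ T.erase i₀} => E j.1)
      fun j => Φ j.1).trans ?_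
    rw [← Finset.sum_coe_sort (T.erase i₀) fun i => Fintype.card (E i) / 2]
    refine Finset.sum_le_sum fun j _ => ?_
    rcases isEmpty_or_nonempty (E j.1) with hE | hE
    · have : Module.finrank ℚ (E j.1 → ℚ) = 0 := by
        rw [Module.finrank_fintype_fun_eq_card, Fintype.card_eq_zero]
      have h0 := Submodule.finrank_le (antiSpan G (Φ j.1))
      omega
    · have hrk := (h j.1).typeRank_le
      rw [(h j.1).typeRank_eq_finrank_antiSpan_add_one] at hrk
      omega
  have hsplit : ∑ i ∈ T, Fintype.card (E i) / 2 = (∑ i ∈ T.erase i₀, Fintype.card (E i) / 2) +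
      Fintype.card (E i₀) / 2 := by
    rw [← Finset.sum_erase_add T _ hi₀]
  omega

/-- **LEAVE-ONE-OUT ⟹ NONDEGENERATE.**  If every member of the sub-family `T` contributes its full `|E_i|/2` on top
of all the others — `dim U(Σ|_T) = dim U(Σ|_{T ∖ {i}}) + |E_i|/2` for all `i ∈ T` — then `dim U(Σ|_T) = Σ_{i∈T} |E_i|/2`
(induction on `|T|`: by submodularity the hypothesis passes to `T ∖ {a}`). [cite: Gordon1999HodgeAVSurvey, §3 Theorem (proof), 7.5–7.7] -/
theorem finrank_antiSpan_sigmaType_eq_sum_of_forall_erase (Φ : ∀ i, Set (E i)) (h : ∀ i, IsCMTypeWith ρ (Φ i)) :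
    ∀ T : Finset I, (∀ i₀ ∈ T, Module.finrank ℚ (antiSpan G (sigmaType fun j : {i // i ∈ T} => Φ j.1)) =
        Module.finrank ℚ (antiSpan G (sigmaType fun j : {i // i ∈ T.erase i₀} => Φ j.1)) +
          Fintype.card (E i₀) / 2) →
      Module.finrank ℚ (antiSpan G (sigmaType fun j : {i // i ∈ T} => Φ j.1)) = ∑ i ∈ T, Fintype.card (E i) / 2 := by
  intro T
  induction T using Finset.induction_on with
  | empty =>
    intro _
    rw [Finset.sum_empty]
    exact finrank_antiSpan_sigmaType_eq_zero_of_isEmpty (G := G) Φ _ fun i hi => Finset.notMem_empty i hi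
  | @insert a S haS ih =>
    intro hyp
    -- the hypothesis at `a`: `d(S ∪ {a}) = d(S) + m_a`
    have ha := hyp a (Finset.mem_insert_self a S)
    rw [Finset.erase_insert haS] at ha
    -- the hypothesis passes to `S`
    have hS : ∀ i₀ ∈ S, Module.finrank ℚ (antiSpan G (sigmaType fun j : {i // i ∈ S} => Φ j.1)) =
        Module.finrank ℚ (antiSpan G (sigmaType fun j : {i // i ∈ S.erase i₀} => Φ j.1)) +
          Fintype.card (E i₀) / 2 := by
      intro i₀ hi₀S
      have hi₀ : i₀ ∈ insert a S := Finset.mem_insert_of_mem hi₀S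
      have hia : i₀ ≠ a := fun h' => haS (h' ▸ hi₀S)
      have hyp₀ := hyp i₀ hi₀
      -- submodularity: `d(insert a S) + d(S.erase i₀) ≤ d(S) + d((insert a S).erase i₀)`
      have hsub := finrank_antiSpan_sigmaType_submodular (G := G) Φ (· ∈ S.erase i₀) (· ∈ (insert a S).erase i₀)
        (· ∈ S) (· ∈ insert a S) (i₀ := i₀)
        (fun i hi => by
          rw [Finset.mem_erase] at hi ⊢
          exact ⟨hi.1, Finset.mem_insert_of_mem hi.2⟩)
        (fun i => by
          rw [Finset.mem_erase]
          constructor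
          · intro hi
            by_cases hii : i = i₀
            · exact Or.inr hii
            · exact Or.inl ⟨hii, hi⟩
          · rintro (⟨-, hi⟩ | rfl)
            · exact hi
            · exact hi₀S)
        (fun i => by
          rw [Finset.mem_erase]
          constructor
          · intro hi
            by_cases hii : i = i₀
            · exact Or.inr hii
            · exact Or.inl ⟨hii, hi⟩
          · rintro (⟨-, hi⟩ | rfl)
            · exact hi
            · exact hi₀)
      -- sub-additivity the other way
      have hle := finrank_antiSpan_sigmaType_insert_le (G := G) Φ h (· ∈ S.erase i₀) (· ∈ S) (i₀ := i₀) fun i => by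
        rw [Finset.mem_erase]
        constructor
        · intro hi
          by_cases hii : i = i₀
          · exact Or.inr hii
          · exact Or.inl ⟨hii, hi⟩
        · rintro (⟨-, hi⟩ | rfl)
          · exact hi
          · exact hi₀S
      omega
    rw [ha, ih hS, Finset.sum_insert haS, add_comm]

/-- **THE LEAVE-ONE-OUT CRITERION** (iff form, dimension level). [cite: Gordon1999HodgeAVSurvey, §3 Theorem (proof), 7.5–7.7] -/
theorem finrank_antiSpan_sigmaType_eq_sum_iff_forall_erase (Φ : ∀ i, Set (E i)) (h : ∀ i, IsCMTypeWith ρ (Φ i))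
    (T : Finset I) :
    Module.finrank ℚ (antiSpan G (sigmaType fun j : {i // i ∈ T} => Φ j.1)) = ∑ i ∈ T, Fintype.card (E i) / 2 ↔
      ∀ i₀ ∈ T, Module.finrank ℚ (antiSpan G (sigmaType fun j : {i // i ∈ T} => Φ j.1)) =
        Module.finrank ℚ (antiSpan G (sigmaType fun j : {i // i ∈ T.erase i₀} => Φ j.1)) +
          Fintype.card (E i₀) / 2 :=
  ⟨fun hT _ hi₀ => finrank_antiSpan_sigmaType_erase_of_eq_sum Φ h T hT hi₀,
    finrank_antiSpan_sigmaType_eq_sum_of_forall_erase Φ h T⟩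

end LeaveOneOut

end Summit.HodgeConjecture.CorCM.IrrOdd

/-! ### §3 CM fields: nondegeneracy is detected by the leave-one-out sub-products -/

namespace Summit.HodgeConjecture.CorCM

open NumberField
open Literature.NumberTheory.ComplexMultiplication
open Literature.AlgebraicGeometry.Motives (CMType)
open Literature.AlgebraicGeometry.Pohlmann1968
open GenericCMField

variable {I : Type} [Fintype I] [DecidableEq I] {K : I → Type} [∀ i, Field (K i)] [∀ i, NumberField (K i)]
  [∀ i, IsCMField (K i)]

omit [Fintype I] [DecidableEq I] in
/-- `rank(Φ|_T) = dim U(Σ|_T) + 1` for a nonempty sub-collection. [cite: Shimura1998, §32.10] -/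
theorem cmFamilyRank_restrict_eq_finrank_add_one (Φ : ∀ i, CMType (K i)) (T : Finset I) (hT : T.Nonempty) :
    CMAlgebra.cmFamilyRank (fun j : T => Φ j.1) =
      Module.finrank ℚ (antiSpan (ℂ ≃+* ℂ) (sigmaType fun j : {i // i ∈ T} => (Φ j.1).1)) + 1 := by
  obtain ⟨j₁, hj₁⟩ := hT
  obtain ⟨s₁⟩ : Nonempty (K j₁ →+* ℂ) := inferInstance
  haveI : Nonempty (Σ j : {j // j ∈ T}, (K j.1 →+* ℂ)) := ⟨⟨⟨j₁, hj₁⟩, s₁⟩⟩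
  exact (IsCMTypeWith.sigmaType (E := fun j : {i // i ∈ T} => K j.1 →+* ℂ)
    fun j => isCMTypeWith_conj (Φ j.1)).typeRank_eq_finrank_antiSpan_add_one

/-- **THE LEAVE-ONE-OUT CRITERION** (any CM fields, at least two members): `(Φ_i)_{i∈I}` is a NONDEGENERATE family
(`Hg(∏ A_i) = ∏ Hg(A_i)`; the Hodge conjecture on all products of powers, tree) IFF for every member `i`,
`dim MT(∏_j A_j) = dim MT(∏_{j ≠ i} A_j) + dim A_i` — every factor adds its full dimension on top of all the others.
[cite: Gordon1999HodgeAVSurvey, §3 Theorem (proof), 7.5–7.7 and 9.1] [cite: Deligne1982HodgeCycles, I Ex. 3.7 (c)–(d)] -/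
theorem isNondegenerateFamily_iff_forall_erase [Nontrivial I] (Φ : ∀ i, CMType (K i)) :
    CMAlgebra.IsNondegenerateFamily Φ ↔ ∀ i : I, CMAlgebra.cmFamilyRank Φ =
      CMAlgebra.cmFamilyRank (fun j : ↥(Finset.univ.erase i) => Φ j.1) + Module.finrank ℚ (K i) / 2 := by
  classical
  -- the whole family is the sub-family over `univ`
  have huniv : CMAlgebra.cmFamilyRank Φ =
      Module.finrank ℚ (antiSpan (ℂ ≃+* ℂ)
        (sigmaType fun j : {i // i ∈ (Finset.univ : Finset I)} => (Φ j.1).1)) + 1 := by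
    obtain ⟨i₁, -⟩ := (inferInstance : Nontrivial I).exists_pair_ne
    obtain ⟨s₁⟩ : Nonempty (K i₁ →+* ℂ) := inferInstance
    haveI : Nonempty (Σ i, (K i →+* ℂ)) := ⟨⟨i₁, s₁⟩⟩
    change typeRank (ℂ ≃+* ℂ) (sigmaType fun i => (Φ i).1) = _
    rw [(IsCMTypeWith.sigmaType fun i => isCMTypeWith_conj (Φ i)).typeRank_eq_finrank_antiSpan_add_one,
      Nat.add_right_cancel_iff]
    refine le_antisymm ?_ (IrrOdd.finrank_antiSpan_sigmaType_reindex_le (E := fun i => K i →+* ℂ)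
      (fun i => (Φ i).1) (Subtype.val : {i // i ∈ (Finset.univ : Finset I)} → I))
    exact IrrOdd.finrank_antiSpan_sigmaType_reindex_le
      (E := fun j : {i // i ∈ (Finset.univ : Finset I)} => K j.1 →+* ℂ) (fun j => (Φ j.1).1)
      (fun i : I => (⟨i, Finset.mem_univ i⟩ : {i // i ∈ (Finset.univ : Finset I)}))
  have hne : ∀ i : I, (Finset.univ.erase i).Nonempty := fun i => by
    obtain ⟨j, hj⟩ := exists_ne i
    exact ⟨j, Finset.mem_erase.2 ⟨hj, Finset.mem_univ j⟩⟩
  have hcard : ∀ i, Fintype.card (K i →+* ℂ) / 2 = Module.finrank ℚ (K i) / 2 := fun i => by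
    rw [Embeddings.card (K i) ℂ]
  rw [CMAlgebra.isNondegenerateFamily_iff, huniv]
  have key := IrrOdd.finrank_antiSpan_sigmaType_eq_sum_iff_forall_erase (G := ℂ ≃+* ℂ) (E := fun i => K i →+* ℂ)
    (fun i => (Φ i).1) (fun i => isCMTypeWith_conj (Φ i)) Finset.univ
  simp only [Finset.mem_univ, true_implies, hcard] at key
  have hsum : (∑ i, Module.finrank ℚ (K i)) / 2 = ∑ i, Module.finrank ℚ (K i) / 2 :=
    Nat.sum_div fun i _ => by
      rw [← Embeddings.card (K i) ℂ]
      exact (isCMTypeWith_conj (Φ i)).two_dvd_card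
  rw [hsum]
  constructor
  · intro hnd i
    rw [cmFamilyRank_restrict_eq_finrank_add_one Φ _ (hne i), (key.1 (by omega)) i]
    ring
  · intro hall
    have : ∀ i, Module.finrank ℚ (antiSpan (ℂ ≃+* ℂ)
        (sigmaType fun j : {j // j ∈ (Finset.univ : Finset I)} => (Φ j.1).1)) =
          Module.finrank ℚ (antiSpan (ℂ ≃+* ℂ)
            (sigmaType fun j : {j // j ∈ Finset.univ.erase i} => (Φ j.1).1)) + Module.finrank ℚ (K i) / 2 := by
      intro i
      have h1 := hall i
      rw [cmFamilyRank_restrict_eq_finrank_add_one Φ _ (hne i)] at h1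
      omega
    rw [key.2 this]

/-- **Degeneracy is witnessed by one member**: if the family is degenerate, some factor `A_i` adds LESS than `dim A_i`
to the Mumford–Tate group of the product of all the others (`rank(Φ) < rank(Φ|_{≠i}) + [K_i:ℚ]/2`; the other
inequality always holds, F7/F8 sub-additivity). [cite: Gordon1999HodgeAVSurvey, 7.5–7.7] -/
theorem exists_cmFamilyRank_lt_of_not_isNondegenerateFamily [Nontrivial I] (Φ : ∀ i, CMType (K i))
    (hΦ : ¬ CMAlgebra.IsNondegenerateFamily Φ) :
    ∃ i : I, CMAlgebra.cmFamilyRank Φ <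
      CMAlgebra.cmFamilyRank (fun j : ↥(Finset.univ.erase i) => Φ j.1) + Module.finrank ℚ (K i) / 2 := by
  classical
  by_contra hcon
  push Not at hcon
  refine hΦ ((isNondegenerateFamily_iff_forall_erase Φ).2 fun i => le_antisymm ?_ (hcon i))
  -- sub-additivity: `rank(Φ) ≤ rank(Φ|_{≠ i}) + [K_i:ℚ]/2`
  have hne : (Finset.univ.erase i).Nonempty := by
    obtain ⟨j, hj⟩ := exists_ne i
    exact ⟨j, Finset.mem_erase.2 ⟨hj, Finset.mem_univ j⟩⟩
  obtain ⟨j₁, hj₁⟩ := hne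
  obtain ⟨s₁⟩ : Nonempty (K j₁ →+* ℂ) := inferInstance
  haveI : Nonempty (Σ j : {j // j ∈ Finset.univ.erase i}, (K j.1 →+* ℂ)) := ⟨⟨⟨j₁, hj₁⟩, s₁⟩⟩
  haveI : Nonempty (Σ j : {j : I // True}, (K j.1 →+* ℂ)) := ⟨⟨⟨j₁, trivial⟩, s₁⟩⟩
  haveI : Nonempty (Σ j : I, (K j →+* ℂ)) := ⟨⟨j₁, s₁⟩⟩
  have hle := IrrOdd.finrank_antiSpan_sigmaType_insert_le (G := ℂ ≃+* ℂ) (E := fun i => K i →+* ℂ)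
    (fun i => (Φ i).1) (fun i => isCMTypeWith_conj (Φ i)) (· ∈ Finset.univ.erase i) (fun _ => True) (i₀ := i)
    fun j => by simp only [Finset.mem_erase, Finset.mem_univ, and_true, true_iff]; exact ne_or_eq j i
  have htrue : CMAlgebra.cmFamilyRank Φ = Module.finrank ℚ (antiSpan (ℂ ≃+* ℂ)
      (sigmaType fun j : {j : I // True} => (Φ j.1).1)) + 1 := by
    change typeRank (ℂ ≃+* ℂ) (sigmaType fun i => (Φ i).1) = _
    rw [(IsCMTypeWith.sigmaType fun i => isCMTypeWith_conj (Φ i)).typeRank_eq_finrank_antiSpan_add_one,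
      Nat.add_right_cancel_iff]
    refine le_antisymm ?_ (IrrOdd.finrank_antiSpan_sigmaType_reindex_le (E := fun i => K i →+* ℂ)
      (fun i => (Φ i).1) (Subtype.val : {j : I // True} → I))
    exact IrrOdd.finrank_antiSpan_sigmaType_reindex_le (E := fun j : {j : I // True} => K j.1 →+* ℂ)
      (fun j => (Φ j.1).1) (fun i : I => (⟨i, trivial⟩ : {j : I // True}))
  rw [htrue, cmFamilyRank_restrict_eq_finrank_add_one Φ _ ⟨j₁, hj₁⟩, ← Embeddings.card (K i) ℂ]
  omega

end Summit.HodgeConjecture.CorCM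

end
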